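import Summits.BirchSwinnertonDyer.BirchSwinnertonDyer.Theorems.GenusKolyvaginAtTwoEquivariantChebotarevAtTwoStepB

/-!
# Route `GenusKolyvaginAtTwo`, LINE 6 of crux `KolyvaginExactAtTwo` (22137), key child Q3′
# (stmt-BirchSwinnertonDyer-24882): McCallum's Step B at `p = 2` for a SIGNED-stable family
# `σ_* c_i = s_i · c_{π i}` (helper, PROVED; seat `bsd-line-gk2-p2` g9, cell `bsd-f1-sign2`)

Q5′ (`equivariantChebotarevAtTwo_of_not_isSquare`, this seat g6) is McCallum 1991 Cor. 3.2 at `2`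
for families `c_1, …, c_r ∈ H¹(K, E[2^M])` that are `τ`-STABLE UNDER A PERMUTATION,
`σ_* c_i = c_{π i}`. The architecture now adopted for Q3′ (memo Q3-ARCH v2 of seat `bsd-line-gk2-p3`;
this seat's S7 `Literature/…/HeegnerPointsKolyvaginSplitDescentProofs`, p622894) runs Kolyvagin's
descent over `ℚ` for the PAIR `(E, E^{(d_K)})`, whose Čebotarev step is applied to MIXED families:
classes of `E` over `ℚ` restrict to `σ_*`-INVARIANT classes in `H¹(K, E[2^M])`, classes of the
twist `E^{(d_K)}` restrict (through `E^D[2^M] = E[2^M]` as `Γ_K`-modules) to `σ_*`-ANTI-invariant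
ones, `σ_* c = -c`; Claim B's family `{x, s, c(ℓ)}` is always mixed. An anti-invariant class fits
the permutation form only as the pair `{c, -c}`, never independent. Hence the SIGNED form
`σ_* c_i = s_i • c_{π i}`, `s_i = ±1` (for `π = id`: McCallum's printed eigenclass families
`c·c_i = ±c_i`; for general `π`: LINE 6's generic `τ`-pairs as well).

In Q5′'s proof the stability hypothesis enters ONLY Step B (the Galois element `ρ` with
`ord [c_i, (ρm)^τ(ρm)] = 2^{N_i}` on `𝒩`). This file is the signed Step B:
* `exists_orders_of_signStable` — targets `x` with `s_i τ(x_{π i}) + x_i` of exact order `2^{N_i}`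
  (same `x` as `exists_orders_of_tauStable`: on an orbit `{i, π i}` one member gets `2^{M−N} P`, the
  other `0`; a fixed point gets `2^{M−N} P`, value `2^{M−N}(s_i τP + P)`, of exact order `2^N`
  because `(1, s_i)` is a free coefficient pair of `E[2^M] = R_M P`, Q1 on `Δ < 0`);
* `h1Eval_conjGalCMH_of_signStable` — `[c_i, τ⁻¹ρτ] = s_i τ[c_{π i}, ρ]` (tree
  `IsLiftOfAut.h1Eval_conjAct`; joint form of `h1Eval_conjGalCMH_of_tauStable` and
  `IsLiftOfAut.h1Eval_conjGalCMH_of_eigen`);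
* `exists_h1Eval_conj_mul_order_signStable` — the Galois element (signed drop-in for
  `exists_h1Eval_conj_mul_order_tauStable`).
Steps C–H are factored in the sibling `…EquivariantChebotarevAtTwoOfGaloisElement`; the signed
Cor. 3.2 is assembled in `…EquivariantChebotarevAtTwoSigned`. Helper for 24882 (`--supports`),
closes nothing; 0 sorry, standard axioms. BSD is not proved by any of this.

References: [McCallumLMS1991] §3 (2), Prop. 3.1, Cor. 3.2 (pp. 279–280); [GrossLMS1991] §9;
[Kolyvagin1989Izv] §3 (the pair `(E, E^D)` over `ℚ` at `l = 2`).
-/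

set_option autoImplicit false
set_option linter.dupNamespace false

noncomputable section

open scoped Classical

namespace Summit.BirchSwinnertonDyer.BirchSwinnertonDyer.Theorems.GenusExact

open WeierstrassCurve Field Finset
open Literature.NumberTheory.EllipticCurves

universe u v

/-! ### §1 Signed Step B, the targets: orders of `s_i τ x_{π i} + x_i` -/

section StepBSigned

variable {T : Type*} [AddCommGroup T]

/-- **Step B targets for a SIGNED-stable family.** `τ` an additive endomorphism of `T`, `P ∈ T` with
`2^M P = 0` and `a P + b τP = 0 ⟹ 2^M ∣ a, b` (`E[2^M] = R_M P`, Q1 on `Δ < 0`); `π` an involution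
of a finite index set, signs `s_i = ±1`, exponents `N_i ≤ e_i ≤ M` with `N_{π i} = N_i`. Then there
is `x : ι → T` with `2^{e_i} x_i = 0` and `s_i τ(x_{π i}) + x_i` of order EXACTLY `2^{N_i}` for every
`i` (same `x` as in `exists_orders_of_tauStable`; a fixed point now has the value
`2^{M−N_i}(s_i τP + P)`, of exact order `2^{N_i}` since `(1, s_i)` is a free coefficient pair).
[cite: McCallumLMS1991, Prop. 3.1, Cor. 3.2 (proof)] -/
theorem exists_orders_of_signStable (τ : T →+ T) {M : ℕ} {P : T}
    (hPM : (2 : ℤ) ^ M • P = 0)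
    (hfree : ∀ a b : ℤ, a • P + b • τ P = 0 → (2 : ℤ) ^ M ∣ a ∧ (2 : ℤ) ^ M ∣ b)
    {ι : Type*} [Fintype ι] (π : ι → ι) (hπ : ∀ i, π (π i) = i)
    (sgn : ι → ℤ) (hsgn : ∀ i, sgn i = 1 ∨ sgn i = -1)
    (e N : ι → ℕ) (hNe : ∀ i, N i ≤ e i) (heM : ∀ i, e i ≤ M) (hNπ : ∀ i, N (π i) = N i) :
    ∃ x : ι → T, (∀ i, (2 : ℤ) ^ e i • x i = 0) ∧
      ∀ i, (2 : ℤ) ^ N i • (sgn i • τ (x (π i)) + x i) = 0 ∧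
        (N i ≠ 0 → (2 : ℤ) ^ (N i - 1) • (sgn i • τ (x (π i)) + x i) ≠ 0) := by
  -- `2^{M-1} P ≠ 0`, `2^{M-1} (s τP) ≠ 0`, `2^{M-1} (s τP + P) ≠ 0` when `M ≠ 0`
  have hndvd : ∀ {M : ℕ}, M ≠ 0 → ¬ (2 : ℤ) ^ M ∣ (2 : ℤ) ^ (M - 1) := fun {M} hM h ↦ by
    have h1 : (2 : ℤ) ^ (M - 1) < (2 : ℤ) ^ M := pow_lt_pow_right₀ (by norm_num) (by omega)
    exact absurd (Int.le_of_dvd (by positivity) h) (not_le.mpr h1)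
  have hndvd' : ∀ {M : ℕ}, M ≠ 0 → ∀ s : ℤ, s = 1 ∨ s = -1 →
      ¬ (2 : ℤ) ^ M ∣ (2 : ℤ) ^ (M - 1) * s := fun {M} hM s hs h ↦ by
    rcases hs with rfl | rfl
    · exact hndvd hM (by rwa [mul_one] at h)
    · exact hndvd hM (by rwa [mul_neg_one, Int.dvd_neg] at h)
  have hP1 : M ≠ 0 → (2 : ℤ) ^ (M - 1) • P ≠ 0 := fun hM h ↦ by
    have := (hfree ((2 : ℤ) ^ (M - 1)) 0 (by rw [h, zero_smul, add_zero])).1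
    exact hndvd hM this
  have hsτP1 : ∀ i, M ≠ 0 → (2 : ℤ) ^ (M - 1) • (sgn i • τ P) ≠ 0 := fun i hM h ↦ by
    have := (hfree 0 ((2 : ℤ) ^ (M - 1) * sgn i) (by rw [mul_smul, h, zero_smul, zero_add])).2
    exact hndvd' hM (sgn i) (hsgn i) this
  have hsum1 : ∀ i, M ≠ 0 → (2 : ℤ) ^ (M - 1) • (sgn i • τ P + P) ≠ 0 := fun i hM h ↦ by
    have := (hfree ((2 : ℤ) ^ (M - 1)) ((2 : ℤ) ^ (M - 1) * sgn i)
      (by rw [smul_add] at h; rw [add_comm, mul_smul]; exact h)).1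
    exact hndvd hM this
  have hτPM : (2 : ℤ) ^ M • τ P = 0 := by rw [← map_zsmul, hPM, map_zero]
  have hsτPM : ∀ i, (2 : ℤ) ^ M • (sgn i • τ P) = 0 := fun i ↦ by
    rw [smul_comm, hτPM, smul_zero]
  -- a choice of representative in each `π`-orbit: `i` is chosen iff `enc i ≤ enc (π i)`
  set enc : ι → ℕ := fun i ↦ (Fintype.equivFin ι i : ℕ) with henc
  have henc_inj : Function.Injective enc := fun i j h ↦
    (Fintype.equivFin ι).injective (Fin.ext h)
  set x : ι → T := fun i ↦ if enc i ≤ enc (π i) then (2 : ℤ) ^ (M - N i) • P else 0 with hx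
  have hNM : ∀ i, N i ≤ M := fun i ↦ (hNe i).trans (heM i)
  refine ⟨x, fun i ↦ ?_, fun i ↦ ?_⟩
  · -- `2^{e i} x i = 0`
    by_cases h : enc i ≤ enc (π i)
    · simp only [hx, h, if_true]
      rw [smul_smul, ← pow_add, show e i + (M - N i) = M + (e i - N i) by
        have := hNe i; have := heM i; omega, pow_add, mul_comm, mul_smul, hPM, smul_zero]
    · simp only [hx, h, if_false, smul_zero]
  · by_cases hfix : π i = i
    · -- a fixed point: value `2^{M-N}(s τP + P)`
      have hval : sgn i • τ (x (π i)) + x i = (2 : ℤ) ^ (M - N i) • (sgn i • τ P + P) := by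
        simp only [hx, hfix, le_refl, if_true, map_zsmul, smul_add]
        rw [smul_comm (sgn i)]
      rw [hval]
      refine zsmul_pow_sub_order (hNM i) ?_ fun hN0 ↦ hsum1 i (by have := hNM i; omega)
      rw [smul_add, hsτPM, hPM, add_zero]
    · by_cases h : enc i ≤ enc (π i)
      · -- `i` is the representative: `x (π i) = 0`, value `2^{M-N} P`
        have hne : ¬ enc (π i) ≤ enc (π (π i)) := by
          rw [hπ]
          intro h'
          exact hfix (henc_inj (le_antisymm h' h))
        have hval : sgn i • τ (x (π i)) + x i = (2 : ℤ) ^ (M - N i) • P := by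
          simp only [hx, h, hne, if_true, if_false, map_zero, smul_zero, zero_add]
        rw [hval]
        exact zsmul_pow_sub_order (hNM i) hPM fun hN0 ↦ hP1 (by have := hNM i; omega)
      · -- `π i` is the representative: `x i = 0`, value `2^{M-N} (s τP)`
        have hle : enc (π i) ≤ enc (π (π i)) := by rw [hπ]; omega
        have hval : sgn i • τ (x (π i)) + x i = (2 : ℤ) ^ (M - N i) • (sgn i • τ P) := by
          simp only [hx, h, hle, if_true, if_false, add_zero, map_zsmul, hNπ]
          rw [smul_comm (sgn i)]
        rw [hval]
        exact zsmul_pow_sub_order (hNM i) (hsτPM i) fun hN0 ↦ hsτP1 i (by have := hNM i; omega)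

end StepBSigned

/-! ### §2 Signed Step B: the Galois element `ρ` -/

section GaloisElement

variable {k : Type v} {K : Type u} [Field k] [Field K] [Algebra k K] (W : WeierstrassCurve k)
variable {σ : K ≃ₐ[k] K} {τ : AlgebraicClosure K ≃+* AlgebraicClosure K}

/-- **`[c_i, τ⁻¹ρτ] = s_i · τ[c_{π i}, ρ]` for a signed-stable family** (`σ_* c_i = s_i c_{π i}`,
any integers `s_i`, `τ` an involutive lift of `σ`, `ρ ∈ Γ_{K(E[n])}`): the tree's `[σ_* x, ρ] = τ[x, τ⁻¹ρτ]`
(`IsLiftOfAut.h1Eval_conjAct`) read on the family; joint generalisation of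
`h1Eval_conjGalCMH_of_tauStable` (`s_i = 1`) and `IsLiftOfAut.h1Eval_conjGalCMH_of_eigen` (`π = id`).
[cite: McCallumLMS1991, Prop. 3.1 (proof)] [cite: GrossLMS1991, §9] -/
theorem h1Eval_conjGalCMH_of_signStable (hτ : IsLiftOfAut σ τ)
    (hinv : ∀ x, τ (τ x) = x) (n : ℤ) {ι : Type*}
    {xs : ι → galH1Torsion (W.baseChange K) n} {π : ι → ι} {sgn : ι → ℤ}
    (hxs : ∀ i, conjAct W σ n (xs i) = sgn i • xs (π i)) {ρ : absoluteGaloisGroup K}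
    (hρ : ρ ∈ torsionFixing (W.baseChange K) n) (i : ι) :
    h1Eval (W.baseChange K) n (xs i) (hτ.conjGalCMH ρ) =
      sgn i • hτ.torsionMap W n (h1Eval (W.baseChange K) n (xs (π i)) ρ) := by
  have h := hτ.h1Eval_conjAct W n (xs i) hρ
  rw [hxs i, h1Eval_zsmul _ n _ _ hρ] at h
  -- `h : s_i [c_{π i}, ρ] = τ [c_i, τ⁻¹ρτ]`; apply the involution `τ`
  have h2 := congrArg (fun y ↦ hτ.torsionMap W n y) h
  simp only [map_zsmul, hτ.torsionMap_torsionMap W hinv] at h2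
  exact h2.symm

/-- **McCallum's Galois element at `p = 2` for a SIGNED-stable family** (signed form of
`exists_h1Eval_conj_mul_order_tauStable`). `K/k` with `σ ∈ Aut(K/k)` and an involutive lift `τ` to
`K̄`; `2 ∣ n`; `E[2]` a simple `Γ_K`-module with scalar commutant; `P ∈ E(K̄)[n]` with `2^M P = 0`
and `a P + b τP = 0 ⟹ 2^M ∣ a, b`; classes `x_i ∈ H¹(K, E[n])` with `σ_* x_i = s_i x_{π i}`
(`π` an involution, `s_i = ±1`), killed by `2^{e_i}`, independent, with restriction to `Γ_{K(E[n])}`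
injective on their span; exponents `N_i ≤ e_i ≤ M` with `N_{π i} = N_i`. Then some
`ρ ∈ Γ_{K(E[n])}` has, for every `m ∈ 𝒩 = {[x_i, ·] = 0 ∀ i}` and every `i`:
`2^{N_i} [x_i, (ρm)^τ(ρm)] = 0` and `2^{N_i − 1} [x_i, (ρm)^τ(ρm)] ≠ 0` (`N_i ≠ 0`).
[cite: McCallumLMS1991, §3 (2), Prop. 3.1, Cor. 3.2] -/
theorem exists_h1Eval_conj_mul_order_signStable [W.IsElliptic] (hτ : IsLiftOfAut σ τ)
    (hinv : ∀ x, τ (τ x) = x) {n : ℤ} (h2n : (2 : ℤ) ∣ n) {M : ℕ}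
    (hS : ∀ H : AddSubgroup (geomTorsion (W.baseChange K) 2),
      (∀ g : absoluteGaloisGroup K, ∀ t ∈ H, g • t ∈ H) → H = ⊥ ∨ H = ⊤)
    (hC : ∀ f : geomTorsion (W.baseChange K) 2 →+ geomTorsion (W.baseChange K) 2,
      (∀ (g : absoluteGaloisGroup K) (t : geomTorsion (W.baseChange K) 2), f (g • t) = g • f t) →
        ∃ c : ℤ, ∀ t, f t = c • t)
    {P : geomTorsion (W.baseChange K) n} (hPM : (2 : ℤ) ^ M • P = 0)
    (hfree : ∀ a b : ℤ, a • P + b • hτ.torsionMap W n P = 0 → (2 : ℤ) ^ M ∣ a ∧ (2 : ℤ) ^ M ∣ b)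
    {ι : Type*} [Fintype ι] {xs : ι → galH1Torsion (W.baseChange K) n} {π : ι → ι}
    (hπ : ∀ i, π (π i) = i) {sgn : ι → ℤ} (hsgn : ∀ i, sgn i = 1 ∨ sgn i = -1)
    (hxs : ∀ i, conjAct W σ n (xs i) = sgn i • xs (π i))
    (e : ι → ℕ) (he : ∀ i, ((2 : ℤ) ^ e i) • xs i = 0)
    (hind : ∀ a : ι → ℤ, ∑ i, a i • xs i = 0 → ∀ i, ((2 : ℤ) ^ e i) ∣ a i)
    (hres : ∀ a : ι → ℤ, (∀ ρ ∈ torsionFixing (W.baseChange K) n,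
      h1Eval (W.baseChange K) n (∑ i, a i • xs i) ρ = 0) → ∑ i, a i • xs i = 0)
    (Nv : ι → ℕ) (hNe : ∀ i, Nv i ≤ e i) (heM : ∀ i, e i ≤ M) (hNπ : ∀ i, Nv (π i) = Nv i) :
    ∃ ρ ∈ torsionFixing (W.baseChange K) n, ∀ m ∈ evalKer (W.baseChange K) n xs, ∀ i,
      ((2 : ℤ) ^ Nv i) • h1Eval (W.baseChange K) n (xs i) (hτ.conjGalCMH (ρ * m) * (ρ * m)) = 0 ∧
      (Nv i ≠ 0 →
        ((2 : ℤ) ^ (Nv i - 1)) • h1Eval (W.baseChange K) n (xs i) (hτ.conjGalCMH (ρ * m) * (ρ * m))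
          ≠ 0) := by
  -- the targets
  obtain ⟨x, hxe, hx⟩ := exists_orders_of_signStable (hτ.torsionMap W n) hPM hfree π hπ sgn hsgn e
    Nv hNe heM hNπ
  -- realise them as evaluations
  obtain ⟨ρ, hρ, hρe⟩ := exists_h1Eval_eq_of_indep_of_res (W.baseChange K) Nat.prime_two h2n hS hC
    xs e he hind hres x hxe
  refine ⟨ρ, hρ, fun m hm i ↦ ?_⟩
  have hρm : ρ * m ∈ torsionFixing (W.baseChange K) n := mul_mem hρ hm.1
  have hval : h1Eval (W.baseChange K) n (xs i) (hτ.conjGalCMH (ρ * m) * (ρ * m)) =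
      sgn i • hτ.torsionMap W n (x (π i)) + x i := by
    rw [h1Eval_mul _ _ _ (hτ.conjGalCMH_mem_torsionFixing W hinv _ hρm),
      h1Eval_conjGalCMH_of_signStable W hτ hinv n hxs hρm, h1Eval_mul _ _ _ hρ,
      h1Eval_mul _ _ _ hρ, hρe i, hρe (π i), hm.2 i, hm.2 (π i), add_zero, add_zero]
  rw [hval]
  exact hx i

end GaloisElement

/-! ### §3 (appended, g9) The CHARACTER form of the signed Step B: arbitrary targets in `ℤP`,
the zero-criterion for every pure class of the span (towards Prop. 3.1 in kernel form at `2`)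

McCallum's Prop. 3.1 (not only Cor. 3.2) is what Kolyvagin's ORDER bound consumes (`hCeb` of the
telescope `KolyvaginDescent.SplitHypothesesM.sum_expo_le_M₀_of_casselsTate`): a prescribed KERNEL
on a finite subgroup `C`, i.e. a prescribed character. At `2` the targets are taken in the line
`ℤP` (`E[2^M] = R_M P`): for a PURE class `g` of the span (`c_* g = s g`, `s = ±1`) the value at
the Frobenius `(ρm)^τ (ρm)` is `(sτ + 1)φ(g) = A·(s τP + P)` with `φ(g) = A·P`, and
`A(sτP + P) = 0 ⟺ 2^M ∣ A ⟺ φ(g) = 0` because `(1, s)` is a free coefficient pair. Mixed classes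
are not served (and cannot be: `(1+τ)R_M ∩ (1−τ)R_M ≅ ℤ/2`), and are never needed by the telescope. -/

section CharacterForm

variable {k : Type v} {K : Type u} [Field k] [Field K] [Algebra k K] (W : WeierstrassCurve k)
variable {σ : K ≃ₐ[k] K} {τ : AlgebraicClosure K ≃+* AlgebraicClosure K}

/-- **Signed Step B, character form.** `K/k` with `σ ∈ Aut(K/k)` and an involutive lift `τ`;
`2 ∣ n`; `E[2]` a simple `Γ_K`-module with scalar commutant; `P ∈ E(K̄)[n]` with `2^M P = 0` and
`a P + b τP = 0 ⟹ 2^M ∣ a, b`; an INDEPENDENT family `x_i ∈ H¹(K, E[n])` killed by `2^{e_i}`, with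
restriction to `Γ_{K(E[n])}` injective on its span; integer TARGETS `coef_i` with
`2^{e_i} coef_i P = 0` (the character `φ : x_i ↦ coef_i • P` of the span). Then some
`ρ ∈ Γ_{K(E[n])}` has `[x_i, ρ] = coef_i • P`, and for every `m ∈ 𝒩 = {[x_i, ·] = 0 ∀ i}` and
every PURE class `g = ∑ aᵢ xᵢ` of the span (`c_* g = s • g`, `s = ±1`):
**`[g, (ρm)^τ (ρm)] = 0 ⟺ φ(g) = (∑ aᵢ coefᵢ) • P = 0`** (McCallum 1991, (2) and (3) of §3 at
`p = 2`). [cite: McCallumLMS1991, §3 (2), (3), Prop. 3.1] -/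
theorem exists_h1Eval_conj_mul_character_signStable [W.IsElliptic] (hτ : IsLiftOfAut σ τ)
    (hinv : ∀ x, τ (τ x) = x) {n : ℤ} (h2n : (2 : ℤ) ∣ n) {M : ℕ}
    (hS : ∀ H : AddSubgroup (geomTorsion (W.baseChange K) 2),
      (∀ g : absoluteGaloisGroup K, ∀ t ∈ H, g • t ∈ H) → H = ⊥ ∨ H = ⊤)
    (hC : ∀ f : geomTorsion (W.baseChange K) 2 →+ geomTorsion (W.baseChange K) 2,
      (∀ (g : absoluteGaloisGroup K) (t : geomTorsion (W.baseChange K) 2), f (g • t) = g • f t) →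
        ∃ c : ℤ, ∀ t, f t = c • t)
    {P : geomTorsion (W.baseChange K) n} (hPM : (2 : ℤ) ^ M • P = 0)
    (hfree : ∀ a b : ℤ, a • P + b • hτ.torsionMap W n P = 0 → (2 : ℤ) ^ M ∣ a ∧ (2 : ℤ) ^ M ∣ b)
    {ι : Type*} [Fintype ι] (xs : ι → galH1Torsion (W.baseChange K) n)
    (e : ι → ℕ) (he : ∀ i, ((2 : ℤ) ^ e i) • xs i = 0)
    (hind : ∀ a : ι → ℤ, ∑ i, a i • xs i = 0 → ∀ i, ((2 : ℤ) ^ e i) ∣ a i)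
    (hres : ∀ a : ι → ℤ, (∀ ρ ∈ torsionFixing (W.baseChange K) n,
      h1Eval (W.baseChange K) n (∑ i, a i • xs i) ρ = 0) → ∑ i, a i • xs i = 0)
    (coef : ι → ℤ) (hcoef : ∀ i, ((2 : ℤ) ^ e i * coef i) • P = 0) :
    ∃ ρ ∈ torsionFixing (W.baseChange K) n, (∀ i, h1Eval (W.baseChange K) n (xs i) ρ = coef i • P) ∧
      ∀ m ∈ evalKer (W.baseChange K) n xs, ∀ (a : ι → ℤ) (s : ℤ), (s = 1 ∨ s = -1) →
        conjAct W σ n (∑ i, a i • xs i) = s • ∑ i, a i • xs i →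
        (h1Eval (W.baseChange K) n (∑ i, a i • xs i) (hτ.conjGalCMH (ρ * m) * (ρ * m)) = 0 ↔
          (∑ i, a i * coef i) • P = 0) := by
  -- realise the character `x_i ↦ coef_i • P`
  obtain ⟨ρ, hρ, hρe⟩ := exists_h1Eval_eq_of_indep_of_res (W.baseChange K) Nat.prime_two h2n hS hC
    xs e he hind hres (fun i ↦ coef i • P) (fun i ↦ by rw [smul_smul]; exact hcoef i)
  refine ⟨ρ, hρ, hρe, fun m hm a s hs hg ↦ ?_⟩
  set g := ∑ i, a i • xs i with hg_def
  set A : ℤ := ∑ i, a i * coef i with hA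
  have hρm : ρ * m ∈ torsionFixing (W.baseChange K) n := mul_mem hρ hm.1
  -- `[g, ρ m] = A • P`
  have hval₀ : h1Eval (W.baseChange K) n g (ρ * m) = A • P := by
    rw [h1Eval_mul _ _ _ hρ, hg_def, h1Eval_sum _ n _ _ hρ, h1Eval_sum _ n _ _ hm.1]
    simp only [h1Eval_zsmul _ n _ _ hρ, h1Eval_zsmul _ n _ _ hm.1, hρe, hm.2, smul_zero,
      Finset.sum_const_zero, add_zero, smul_smul]
    rw [hA, Finset.sum_smul]
  -- `[g, (ρm)^τ (ρm)] = s τ(A P) + A P = A • (s τP + P)`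
  have hval : h1Eval (W.baseChange K) n g (hτ.conjGalCMH (ρ * m) * (ρ * m)) =
      A • (s • hτ.torsionMap W n P + P) := by
    rw [h1Eval_mul _ _ _ (hτ.conjGalCMH_mem_torsionFixing W hinv _ hρm),
      hτ.h1Eval_conjGalCMH_of_eigen W hinv n hs hg hρm, hval₀, map_zsmul, smul_add, smul_comm s A]
  rw [hval]
  -- `A (s τP + P) = 0 ⟺ 2^M ∣ A ⟺ A P = 0`
  constructor
  · intro h0
    have h1 : A • P + (A * s) • hτ.torsionMap W n P = 0 := by
      rw [mul_smul, ← smul_add, add_comm]; exact h0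
    obtain ⟨hA2, -⟩ := hfree A (A * s) h1
    obtain ⟨q, hq⟩ := hA2
    rw [hq, mul_comm, mul_smul, hPM, smul_zero]
  · intro h0
    obtain ⟨hA2, -⟩ := hfree A 0 (by rw [h0, zero_smul, add_zero])
    obtain ⟨q, hq⟩ := hA2
    have hτPM : (2 : ℤ) ^ M • hτ.torsionMap W n P = 0 := by rw [← map_zsmul, hPM, map_zero]
    rw [hq, mul_comm, mul_smul, smul_add, smul_comm ((2 : ℤ) ^ M) s, hτPM, hPM, smul_zero,
      add_zero, smul_zero]

end CharacterForm

end Summit.BirchSwinnertonDyer.BirchSwinnertonDyer.Theorems.GenusExact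

end
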